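import Literature.Analysis.FunctionSpaces.LittlewoodPaleySquareFunction
import Literature.Analysis.FunctionSpaces.FourierSobolevNorm
import HarnessLib

/-!
# The weighted Littlewood–Paley square function on `L²`: `Ḃ^s_{2,2} = Ḣ^s`, every real `s`

Analysis/FunctionSpaces file (Bahouri–Chemin–Danchin 2011, §2.3: the homogeneous Besov space
`Ḃ^s_{2,2}` coincides with the homogeneous Sobolev space `Ḣ^s`, with equivalent norms). For the
homogeneous blocks `Δ̇_j = φ_j(D)` of `LittlewoodPaley.lean`, an `L²` function `f : E → F` (`F` a complex
Hilbert space) and ANY real `s`, all **proved** here by Plancherel (the weight-free case `s = 0` is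
`LittlewoodPaleySquareFunction.lean`):

* `rpow_le_of_lt_two_mul` (real bookkeeping) and `weight_le_of_dyadicSymbol_ne_zero`: on the support of
  `φ_j` (`2^{j-1} < ‖ξ‖ < 2^{j+1}`, BCD Prop. 2.10) the weight `2^{2sj}` and `‖ξ‖^{2s}` agree up to the
  factor `2^{|2s|}`, in either direction;
* `tsum_weight_mul_enorm_dyadicSymbol_sq_le`, `enorm_rpow_le_tsum_weight_mul_enorm_dyadicSymbol_sq`:
  `∑_j 2^{2sj} |φ_j(ξ)|² ≤ 8 · 2^{|2s|} ‖ξ‖^{2s}` everywhere and `‖ξ‖^{2s} ≤ 2 · 2^{|2s|} ∑_j 2^{2sj} |φ_j(ξ)|²`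
  off the origin (`∑_j |φ_j|² ∈ [1/2, 8]`);
* **the weighted square function theorem** `tsum_weight_mul_eLpNormDistrib_lpBlock_sq_le`:
  `∑_j 2^{2sj} ‖Δ̇_j f‖²_{L²} ≤ 8 · 2^{|2s|} ‖f‖²_{Ḣ^s}` and `eHomSobolevSeminorm_sq_le_tsum_weight`:
  `‖f‖²_{Ḣ^s} ≤ 2 · 2^{|2s|} ∑_j 2^{2sj} ‖Δ̇_j f‖²_{L²}`, where `‖f‖_{Ḣ^s} = eHomSobolevSeminorm s f =
  (∫ ‖ξ‖^{2s} ‖𝓕f(ξ)‖² dξ)^{1/2}` (`FourierSobolevNorm.lean`) — i.e. `Ḃ^s_{2,2} = Ḣ^s` with equivalent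
  (semi)norms, the constants `8 · 2^{|2s|}`, `2 · 2^{|2s|}` coming from the non-monotone cutoff (BCD's
  are `C^{±1}` with an unspecified `C`).

## References

* H. Bahouri, J.-Y. Chemin, R. Danchin, *Fourier Analysis and Nonlinear Partial Differential Equations*,
  Grundlehren 343, Springer 2011, Prop. 2.10 and §2.3 (the identification `Ḃ^s_{2,2} = Ḣ^s`).
  [BahouriCheminDanchin2011]
-/

noncomputable section

open MeasureTheory FourierTransform SchwartzMap TemperedDistribution Filter Topology Function Set
open scoped ENNReal NNReal FourierTransform

namespace Literature.Analysis.FunctionSpaces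

/-! ## The weights on the support of the dyadic symbols -/

section Symbol

variable {E : Type*} [NormedAddCommGroup E] [InnerProductSpace ℝ E]

/-- **Two positive numbers within a factor `2` of each other have comparable real powers**: if
`0 < X < 2a` and `a < 2X` then `X^e ≤ 2^{|e|} a^e` and `a^e ≤ 2^{|e|} X^e` for every real `e`
(monotonicity of `x ↦ x^e` for `e ≥ 0`, antitonicity for `e ≤ 0`).
[cite: BahouriCheminDanchin2011, Prop. 2.10] -/
theorem rpow_le_of_lt_two_mul {X a e : ℝ} (hX : 0 < X) (h1 : X < 2 * a) (h2 : a < 2 * X) :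
    X ^ e ≤ (2 : ℝ) ^ |e| * a ^ e ∧ a ^ e ≤ (2 : ℝ) ^ |e| * X ^ e := by
  have ha : 0 < a := by linarith
  rcases le_or_gt 0 e with he | he
  · rw [abs_of_nonneg he]
    constructor
    · calc X ^ e ≤ (2 * a) ^ e := Real.rpow_le_rpow hX.le h1.le he
        _ = 2 ^ e * a ^ e := Real.mul_rpow zero_le_two ha.le
    · calc a ^ e ≤ (2 * X) ^ e := Real.rpow_le_rpow ha.le h2.le he
        _ = 2 ^ e * X ^ e := Real.mul_rpow zero_le_two hX.le
  · rw [abs_of_neg he]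
    have anti := Real.antitoneOn_rpow_Ioi_of_exponent_nonpos he.le
    constructor
    · have h3 : a / 2 ≤ X := by linarith
      calc X ^ e ≤ (a / 2) ^ e := anti (mem_Ioi.2 (by positivity)) (mem_Ioi.2 hX) h3
        _ = 2 ^ (-e) * a ^ e := by
            rw [Real.div_rpow ha.le zero_le_two, Real.rpow_neg zero_le_two, div_eq_mul_inv, mul_comm]
    · have h3 : X / 2 ≤ a := by linarith
      calc a ^ e ≤ (X / 2) ^ e := anti (mem_Ioi.2 (by positivity)) (mem_Ioi.2 ha) h3
        _ = 2 ^ (-e) * X ^ e := by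
            rw [Real.div_rpow hX.le zero_le_two, Real.rpow_neg zero_le_two, div_eq_mul_inv, mul_comm]

/-- **The support of `φ_j`**: `φ_j(ξ) ≠ 0` forces `2^{j−1} < ‖ξ‖ < 2^{j+1}` (BCD Prop. 2.10,
`dyadicSymbol_apply_of_norm_le_holds` / `dyadicSymbol_apply_of_le_norm_holds`).
[cite: BahouriCheminDanchin2011, Prop. 2.10] -/
theorem norm_mem_Ioo_of_dyadicSymbol_ne_zero {j : ℤ} {ξ : E} (h : dyadicSymbol j ξ ≠ 0) :
    (2 : ℝ) ^ (j - 1) < ‖ξ‖ ∧ ‖ξ‖ < (2 : ℝ) ^ (j + 1) :=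
  ⟨lt_of_not_ge fun hle => h (dyadicSymbol_apply_of_norm_le_holds hle),
    lt_of_not_ge fun hle => h (dyadicSymbol_apply_of_le_norm_holds hle)⟩

/-- **The weights on the support of `φ_j`**: if `φ_j(ξ) ≠ 0` then, for every real `s`,
`2^{2sj} ≤ 2^{|2s|} ‖ξ‖^{2s}` and `‖ξ‖^{2s} ≤ 2^{|2s|} 2^{2sj}` (in `ℝ≥0∞`).
[cite: BahouriCheminDanchin2011, Prop. 2.10] -/
theorem weight_le_of_dyadicSymbol_ne_zero (s : ℝ) {j : ℤ} {ξ : E} (h : dyadicSymbol j ξ ≠ 0) :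
    (2 : ℝ≥0∞) ^ (2 * s * (j : ℝ)) ≤ (2 : ℝ≥0∞) ^ |2 * s| * ‖ξ‖ₑ ^ (2 * s) ∧
      ‖ξ‖ₑ ^ (2 * s) ≤ (2 : ℝ≥0∞) ^ |2 * s| * (2 : ℝ≥0∞) ^ (2 * s * (j : ℝ)) := by
  obtain ⟨h1, h2⟩ := norm_mem_Ioo_of_dyadicSymbol_ne_zero h
  have ha : 0 < ‖ξ‖ := lt_of_le_of_lt (by positivity) h1
  set X : ℝ := (2 : ℝ) ^ (j : ℝ) with hX
  have hX0 : 0 < X := by positivity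
  have hXj : X = (2 : ℝ) ^ j := Real.rpow_intCast 2 j
  have hlt1 : X < 2 * ‖ξ‖ := by
    have e1 : (2 : ℝ) ^ (j - 1) = (2 : ℝ) ^ j * 2⁻¹ := zpow_sub_one₀ two_ne_zero j
    rw [hXj]; rw [e1] at h1; linarith
  have hlt2 : ‖ξ‖ < 2 * X := by
    have e2 : (2 : ℝ) ^ (j + 1) = (2 : ℝ) ^ j * 2 := zpow_add_one₀ two_ne_zero j
    rw [hXj]; rw [e2] at h2; linarith
  obtain ⟨r1, r2⟩ := rpow_le_of_lt_two_mul (e := 2 * s) hX0 hlt1 hlt2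
  have eW : (2 : ℝ≥0∞) ^ (2 * s * (j : ℝ)) = ENNReal.ofReal (X ^ (2 * s)) := by
    rw [hX, ← Real.rpow_mul zero_le_two, mul_comm (j : ℝ), ← ENNReal.ofReal_rpow_of_pos two_pos,
      ENNReal.ofReal_ofNat]
  have eN : ‖ξ‖ₑ ^ (2 * s) = ENNReal.ofReal (‖ξ‖ ^ (2 * s)) := by
    rw [← ofReal_norm, ENNReal.ofReal_rpow_of_pos ha]
  have eC : (2 : ℝ≥0∞) ^ |2 * s| = ENNReal.ofReal ((2 : ℝ) ^ |2 * s|) := by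
    rw [← ENNReal.ofReal_rpow_of_pos two_pos, ENNReal.ofReal_ofNat]
  rw [eW, eN, eC, ← ENNReal.ofReal_mul (by positivity), ← ENNReal.ofReal_mul (by positivity)]
  exact ⟨ENNReal.ofReal_le_ofReal r1, ENNReal.ofReal_le_ofReal r2⟩

/-- **The weighted squares of the dyadic symbols sum to at most `8 · 2^{|2s|} ‖ξ‖^{2s}`** (at most
two symbols are nonzero at each `ξ`, `∑_j |φ_j|² ≤ 8`, and on the support the weight is `≤ 2^{|2s|}‖ξ‖^{2s}`).
[cite: BahouriCheminDanchin2011, Prop. 2.10] -/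
theorem tsum_weight_mul_enorm_dyadicSymbol_sq_le (s : ℝ) (ξ : E) :
    ∑' j : ℤ, (2 : ℝ≥0∞) ^ (2 * s * (j : ℝ)) * ‖dyadicSymbol j ξ‖ₑ ^ 2 ≤
      8 * (2 : ℝ≥0∞) ^ |2 * s| * ‖ξ‖ₑ ^ (2 * s) := by
  have hterm : ∀ j : ℤ, (2 : ℝ≥0∞) ^ (2 * s * (j : ℝ)) * ‖dyadicSymbol j ξ‖ₑ ^ 2 ≤
      ((2 : ℝ≥0∞) ^ |2 * s| * ‖ξ‖ₑ ^ (2 * s)) * ‖dyadicSymbol j ξ‖ₑ ^ 2 := by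
    intro j
    by_cases h : dyadicSymbol j ξ = 0
    · simp [h]
    · exact mul_le_mul_left (weight_le_of_dyadicSymbol_ne_zero s h).1 _
  calc ∑' j : ℤ, (2 : ℝ≥0∞) ^ (2 * s * (j : ℝ)) * ‖dyadicSymbol j ξ‖ₑ ^ 2
      ≤ ∑' j : ℤ, ((2 : ℝ≥0∞) ^ |2 * s| * ‖ξ‖ₑ ^ (2 * s)) * ‖dyadicSymbol j ξ‖ₑ ^ 2 :=
        ENNReal.tsum_le_tsum hterm
    _ = ((2 : ℝ≥0∞) ^ |2 * s| * ‖ξ‖ₑ ^ (2 * s)) * ∑' j : ℤ, ‖dyadicSymbol j ξ‖ₑ ^ 2 :=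
        ENNReal.tsum_mul_left
    _ ≤ ((2 : ℝ≥0∞) ^ |2 * s| * ‖ξ‖ₑ ^ (2 * s)) * 8 := by
        gcongr
        exact tsum_enorm_dyadicSymbol_sq_le ξ
    _ = 8 * (2 : ℝ≥0∞) ^ |2 * s| * ‖ξ‖ₑ ^ (2 * s) := by ring

/-- **The weight `‖ξ‖^{2s}` is controlled by the weighted squares of the symbols** off the origin:
`‖ξ‖^{2s} ≤ 2 · 2^{|2s|} ∑_j 2^{2sj} |φ_j(ξ)|²` for `ξ ≠ 0` (`∑_j |φ_j|² ≥ 1/2`, and on the support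
`‖ξ‖^{2s} ≤ 2^{|2s|} 2^{2sj}`). [cite: BahouriCheminDanchin2011, Prop. 2.10] -/
theorem enorm_rpow_le_tsum_weight_mul_enorm_dyadicSymbol_sq (s : ℝ) {ξ : E} (hξ : ξ ≠ 0) :
    ‖ξ‖ₑ ^ (2 * s) ≤
      2 * (2 : ℝ≥0∞) ^ |2 * s| * ∑' j : ℤ, (2 : ℝ≥0∞) ^ (2 * s * (j : ℝ)) * ‖dyadicSymbol j ξ‖ₑ ^ 2 := by
  have hterm : ∀ j : ℤ, ‖dyadicSymbol j ξ‖ₑ ^ 2 * ‖ξ‖ₑ ^ (2 * s) ≤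
      (2 : ℝ≥0∞) ^ |2 * s| * ((2 : ℝ≥0∞) ^ (2 * s * (j : ℝ)) * ‖dyadicSymbol j ξ‖ₑ ^ 2) := by
    intro j
    by_cases h : dyadicSymbol j ξ = 0
    · simp [h]
    · calc ‖dyadicSymbol j ξ‖ₑ ^ 2 * ‖ξ‖ₑ ^ (2 * s)
          ≤ ‖dyadicSymbol j ξ‖ₑ ^ 2 * ((2 : ℝ≥0∞) ^ |2 * s| * (2 : ℝ≥0∞) ^ (2 * s * (j : ℝ))) :=
            mul_le_mul_right (weight_le_of_dyadicSymbol_ne_zero s h).2 _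
        _ = _ := by ring
  have hhalf := half_le_tsum_enorm_dyadicSymbol_sq hξ
  calc ‖ξ‖ₑ ^ (2 * s) = 2 * (2⁻¹ * ‖ξ‖ₑ ^ (2 * s)) := by
        rw [← mul_assoc, ENNReal.mul_inv_cancel two_ne_zero ENNReal.ofNat_ne_top, one_mul]
    _ ≤ 2 * ((∑' j : ℤ, ‖dyadicSymbol j ξ‖ₑ ^ 2) * ‖ξ‖ₑ ^ (2 * s)) := by gcongr
    _ = 2 * ∑' j : ℤ, ‖dyadicSymbol j ξ‖ₑ ^ 2 * ‖ξ‖ₑ ^ (2 * s) := by rw [ENNReal.tsum_mul_right]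
    _ ≤ 2 * ∑' j : ℤ, (2 : ℝ≥0∞) ^ |2 * s| * ((2 : ℝ≥0∞) ^ (2 * s * (j : ℝ)) * ‖dyadicSymbol j ξ‖ₑ ^ 2) :=
        mul_le_mul_right (ENNReal.tsum_le_tsum hterm) 2
    _ = 2 * (2 : ℝ≥0∞) ^ |2 * s| * ∑' j : ℤ, (2 : ℝ≥0∞) ^ (2 * s * (j : ℝ)) * ‖dyadicSymbol j ξ‖ₑ ^ 2 := by
        rw [ENNReal.tsum_mul_left, mul_assoc]

end Symbol

/-! ## The weighted square function theorem: `Ḃ^s_{2,2} = Ḣ^s` -/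

section Plancherel

variable {E : Type*} [NormedAddCommGroup E] [InnerProductSpace ℝ E] [FiniteDimensional ℝ E]
  [MeasurableSpace E] [BorelSpace E]
variable {F : Type*} [NormedAddCommGroup F] [InnerProductSpace ℂ F] [CompleteSpace F]

/-- The weights `2^y`, `y ∈ ℝ`, are finite in `ℝ≥0∞`. [cite: BahouriCheminDanchin2011, Prop. 2.10] -/
theorem two_rpow_ne_top (y : ℝ) : (2 : ℝ≥0∞) ^ y ≠ ∞ := by
  rw [Ne, ENNReal.rpow_eq_top_iff]; push Not
  exact ⟨fun h => absurd h two_ne_zero, fun h => absurd h ENNReal.ofNat_ne_top⟩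

/-- The square of the homogeneous Sobolev seminorm is the weighted Plancherel integral:
`‖f‖²_{Ḣ^s} = ∫ ‖ξ‖^{2s} ‖𝓕f(ξ)‖² dξ`. [cite: BahouriCheminDanchin2011, Def. 1.31] -/
theorem eHomSobolevSeminorm_sq (s : ℝ) (f : Lp F 2 (volume : Measure E)) :
    eHomSobolevSeminorm s f ^ 2 =
      ∫⁻ ξ, ‖ξ‖ₑ ^ (2 * s) * ‖((𝓕 f : Lp F 2 (volume : Measure E)) : E → F) ξ‖ₑ ^ 2 := by
  rw [eHomSobolevSeminorm, ← ENNReal.rpow_natCast, ← ENNReal.rpow_mul]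
  norm_num

/-- **The weighted square function, upper bound (`Ḣ^s ⊂ Ḃ^s_{2,2}`)**: for `f ∈ L²` and every real `s`,
`∑_j 2^{2sj} ‖Δ̇_j f‖²_{L²} ≤ 8 · 2^{|2s|} · ‖f‖²_{Ḣ^s}` (Plancherel for each multiplier `φ_j(D)`, Tonelli,
and `∑_j 2^{2sj}|φ_j(ξ)|² ≤ 8 · 2^{|2s|}‖ξ‖^{2s}`). [cite: BahouriCheminDanchin2011, §2.3 (Ḃ^s_{2,2} = Ḣ^s)] -/
theorem tsum_weight_mul_eLpNormDistrib_lpBlock_sq_le (s : ℝ) (f : Lp F 2 (volume : Measure E)) :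
    ∑' j : ℤ, (2 : ℝ≥0∞) ^ (2 * s * (j : ℝ)) * eLpNormDistrib 2 (lpBlock j (f : 𝓢'(E, F))) ^ 2 ≤
      8 * (2 : ℝ≥0∞) ^ |2 * s| * eHomSobolevSeminorm s f ^ 2 := by
  have hrep : ∀ j : ℤ, (2 : ℝ≥0∞) ^ (2 * s * (j : ℝ)) * eLpNormDistrib 2 (lpBlock j (f : 𝓢'(E, F))) ^ 2 =
      ∫⁻ ξ, (2 : ℝ≥0∞) ^ (2 * s * (j : ℝ)) *
        (‖dyadicSymbol j ξ‖ₑ ^ 2 * ‖((𝓕 f : Lp F 2 (volume : Measure E)) : E → F) ξ‖ₑ ^ 2) := fun j => by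
    have h0 : eLpNormDistrib 2 (lpBlock j (f : 𝓢'(E, F))) ^ 2 =
        ∫⁻ ξ, ‖dyadicSymbol j ξ‖ₑ ^ 2 * ‖((𝓕 f : Lp F 2 (volume : Measure E)) : E → F) ξ‖ₑ ^ 2 :=
      eLpNormDistrib_fourierMultiplierCLM_coe_sq (hasTemperateGrowth_dyadicSymbol j) (memLp_top_dyadicSymbol j) f
    rw [h0, lintegral_const_mul' _ _ (two_rpow_ne_top _)]
  simp_rw [hrep]
  have hmeas : ∀ j : ℤ, AEMeasurable (fun ξ => (2 : ℝ≥0∞) ^ (2 * s * (j : ℝ)) *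
      (‖dyadicSymbol (E := E) j ξ‖ₑ ^ 2 * ‖((𝓕 f : Lp F 2 (volume : Measure E)) : E → F) ξ‖ₑ ^ 2)) volume :=
    fun j => ((((contDiff_dyadicSymbol j).continuous.measurable.enorm.pow_const 2).aemeasurable.mul
      ((Lp.aestronglyMeasurable _).enorm.pow_const 2))).const_mul _
  rw [← lintegral_tsum hmeas, eHomSobolevSeminorm_sq,
    ← lintegral_const_mul' _ _ (ENNReal.mul_ne_top (by norm_num) (two_rpow_ne_top _))]
  refine lintegral_mono fun ξ => ?_
  have e : ∑' j : ℤ, (2 : ℝ≥0∞) ^ (2 * s * (j : ℝ)) *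
      (‖dyadicSymbol j ξ‖ₑ ^ 2 * ‖((𝓕 f : Lp F 2 (volume : Measure E)) : E → F) ξ‖ₑ ^ 2) =
      (∑' j : ℤ, (2 : ℝ≥0∞) ^ (2 * s * (j : ℝ)) * ‖dyadicSymbol j ξ‖ₑ ^ 2) *
        ‖((𝓕 f : Lp F 2 (volume : Measure E)) : E → F) ξ‖ₑ ^ 2 := by
    rw [← ENNReal.tsum_mul_right]
    exact tsum_congr fun j => by ring
  rw [e]
  exact (mul_le_mul_left (tsum_weight_mul_enorm_dyadicSymbol_sq_le s ξ) _).trans_eq (by ring)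

/-- **The weighted square function, lower bound (`Ḃ^s_{2,2} ⊂ Ḣ^s`)**: for `f ∈ L²` and every real
`s`, `‖f‖²_{Ḣ^s} ≤ 2 · 2^{|2s|} · ∑_j 2^{2sj} ‖Δ̇_j f‖²_{L²}` (`‖ξ‖^{2s} ≤ 2 · 2^{|2s|} ∑_j 2^{2sj}|φ_j(ξ)|²` off
the origin, a null set). Together with `tsum_weight_mul_eLpNormDistrib_lpBlock_sq_le`: `Ḃ^s_{2,2} = Ḣ^s`
with equivalent norms (`s = 0`: `LittlewoodPaleySquareFunction`). [cite: BahouriCheminDanchin2011, §2.3 (Ḃ^s_{2,2} = Ḣ^s)] -/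
theorem eHomSobolevSeminorm_sq_le_tsum_weight [Nontrivial E] (s : ℝ) (f : Lp F 2 (volume : Measure E)) :
    eHomSobolevSeminorm s f ^ 2 ≤
      2 * (2 : ℝ≥0∞) ^ |2 * s| *
        ∑' j : ℤ, (2 : ℝ≥0∞) ^ (2 * s * (j : ℝ)) * eLpNormDistrib 2 (lpBlock j (f : 𝓢'(E, F))) ^ 2 := by
  have hrep : ∀ j : ℤ, (2 : ℝ≥0∞) ^ (2 * s * (j : ℝ)) * eLpNormDistrib 2 (lpBlock j (f : 𝓢'(E, F))) ^ 2 =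
      ∫⁻ ξ, (2 : ℝ≥0∞) ^ (2 * s * (j : ℝ)) *
        (‖dyadicSymbol j ξ‖ₑ ^ 2 * ‖((𝓕 f : Lp F 2 (volume : Measure E)) : E → F) ξ‖ₑ ^ 2) := fun j => by
    have h0 : eLpNormDistrib 2 (lpBlock j (f : 𝓢'(E, F))) ^ 2 =
        ∫⁻ ξ, ‖dyadicSymbol j ξ‖ₑ ^ 2 * ‖((𝓕 f : Lp F 2 (volume : Measure E)) : E → F) ξ‖ₑ ^ 2 :=
      eLpNormDistrib_fourierMultiplierCLM_coe_sq (hasTemperateGrowth_dyadicSymbol j) (memLp_top_dyadicSymbol j) f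
    rw [h0, lintegral_const_mul' _ _ (two_rpow_ne_top _)]
  simp_rw [hrep]
  have hmeas : ∀ j : ℤ, AEMeasurable (fun ξ => (2 : ℝ≥0∞) ^ (2 * s * (j : ℝ)) *
      (‖dyadicSymbol (E := E) j ξ‖ₑ ^ 2 * ‖((𝓕 f : Lp F 2 (volume : Measure E)) : E → F) ξ‖ₑ ^ 2)) volume :=
    fun j => ((((contDiff_dyadicSymbol j).continuous.measurable.enorm.pow_const 2).aemeasurable.mul
      ((Lp.aestronglyMeasurable _).enorm.pow_const 2))).const_mul _
  rw [← lintegral_tsum hmeas, eHomSobolevSeminorm_sq,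
    ← lintegral_const_mul' _ _ (ENNReal.mul_ne_top (by norm_num) (two_rpow_ne_top _))]
  -- off the origin `‖ξ‖^{2s} ≤ 2 · 2^{|2s|} ∑_j 2^{2sj}|φ_j|²`
  have hae : ∀ᵐ ξ : E ∂volume, ξ ≠ 0 := by
    have : (volume : Measure E) {0} = 0 := measure_singleton 0
    filter_upwards [measure_eq_zero_iff_ae_notMem.1 this] with ξ hξ
    simpa using hξ
  refine lintegral_mono_ae ?_
  filter_upwards [hae] with ξ hξ
  have e : ∑' j : ℤ, (2 : ℝ≥0∞) ^ (2 * s * (j : ℝ)) *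
      (‖dyadicSymbol j ξ‖ₑ ^ 2 * ‖((𝓕 f : Lp F 2 (volume : Measure E)) : E → F) ξ‖ₑ ^ 2) =
      (∑' j : ℤ, (2 : ℝ≥0∞) ^ (2 * s * (j : ℝ)) * ‖dyadicSymbol j ξ‖ₑ ^ 2) *
        ‖((𝓕 f : Lp F 2 (volume : Measure E)) : E → F) ξ‖ₑ ^ 2 := by
    rw [← ENNReal.tsum_mul_right]
    exact tsum_congr fun j => by ring
  rw [e]
  exact (mul_le_mul_left (enorm_rpow_le_tsum_weight_mul_enorm_dyadicSymbol_sq s hξ) _).trans_eq (by ring)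

end Plancherel

end Literature.Analysis.FunctionSpaces

end
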